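import Literature.NumberTheory.Rogawski1990.ArchDeltaTransferCentralVanishing          -- ★ (S-c): the curve∕frame∕congruence cone (`isArchGRegular_archSingularCurve`, `archCongrOfEq_quasiSplitFrameTwo_symm_archDiagTorus`, …)
import Literature.NumberTheory.Rogawski1990.ArchEndoscopicCurveRegularCompact            -- ★ (3R-G′) regularity ∕ compact centralisers along B-p12's curve
import Literature.NumberTheory.Rogawski1990.ArchDeltaClassSumCongruence                  -- ★ (α) `compactSpace_centralizer_of_isArchNormPair_of_archCongr`
import Literature.NumberTheory.Rogawski1990.ArchCanonicalSingularHaar                   -- ★ `IsQuotientOf.isHaarMeasure_of_isAdmissibleOn`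
import Literature.NumberTheory.Rogawski1990.ArchCompatibleFamiliesScalar                -- ★ `isArchGRegular_conj`
import Literature.NumberTheory.Automorphic.OrbitalMeasureFamilyRegular                    -- ★ `isMulRightInvariant_prod`
import Literature.NumberTheory.Automorphic.UnitaryGroupArchUnimodular                     -- ★ `modularCharacterFun_arch_eq_one`
import HarnessLib

/-!
# `K2E4ExplicitArchSingularTransferEngine` — the bookkeeping bricks of the #9 assembly: the JOINT place-by-place induction (★ p854825, restated), the local
# regularity of the central curve, the speed-0 adapter for ★ (β₀), and the Haar property of `νHi` (Rogawski 1990 Prop. 8.2.1 (a), §8.2 pp. 118–124)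

Track B ∕ K2-LIT, crux h413 = `stmt-HodgeConjecture-24833`; prover seat `hodgecm-mathlib-K2E4-p09` (g0); lane `--supports stmt-HodgeConjecture-24833 --as helper`.
THEOREMS ONLY (no `def`, no `instance`, no notation, no `sorry`).  Consumer: `Theorems/K2E4ExplicitArchSingularTransferOfPackages.lean` (same seat).
* §0–§1 `injective_of_pairwise_ne_three`, **`joint_induction`** (= ★ `K2E4ArchSingularKernelPlaceInduction.eq_of_step_of_regular_eq`, K2E4-p11 p854825, restated here because
  that module is accepted but not yet built on the check farm; adapted verbatim), `eventually_nhdsGT_regular_centralCurve`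
  (the central curve `(z e^{iψ}, z e^{−iψ})` is `G`-regular against `δ ≠ z` locally near `ψ = 0⁺`), `deriv_two_sin_smul_const_mul`.
* §2 `twoBlockPoint_isArchGRegular_and_compactSpace` (the binders `hreg`, `hZ′` of ★ (β₀) `exists_sum_integral_pi_eq_inv_mul_finsum_delta` at EVERY regular 2-block datum —
  B-p12's curve at speed 0), `isHaarMeasure_H_of_isQuotientOf` (`νHi` is Haar under (iii)+(W_H) of `ArchCanonicalSingularMatrix`, given one `G`-regular point).
HONEST LABEL: HC_CM is proved only modulo the 7 printed citations (2 remaining named inputs: hLiu418 = `stmt-HodgeConjecture-24832`, h413 = `stmt-HodgeConjecture-24833`) until rung 0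
closes; this file is bookkeeping and pays nothing by itself.

## References
* [Rogawski1990] J. D. Rogawski, *Automorphic Representations of Unitary Groups in Three Variables*, Ann. of Math. Stud. 123 (1990): Prop. 8.2.1 (a) pp. 118–119; §8.2 pp. 122–124;
  §14.5 Lemma 14.5.2 (b) pp. 238–239; §3.1 p. 19; §14.3 p. 234; §1.7 p. 6.
* [Varadarajan1989] V. S. Varadarajan, *An Introduction to Harmonic Analysis on Semisimple Lie Groups* (1989), §6.4 Thm 22.
* [Folland1999] G. B. Folland, *Real Analysis*, 2nd ed. (1999), Thm 11.9.
-/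

set_option autoImplicit false
-- the mandated namespace repeats the single-problem summit's segment (`HodgeConjecture.HodgeConjecture`)
set_option linter.dupNamespace false

noncomputable section

open MeasureTheory Measure NumberField NumberField.InfinitePlace NumberField.mixedEmbedding IsDedekindDomain Filter Topology Set
open Literature.MeasureTheory.Group
open Literature.NumberTheory.Rogawski1990 Literature.NumberTheory.Automorphic Literature.NumberTheory.GaloisRepresentations
open Literature.AlgebraicGeometry.ShimuraVarieties (unitaryGroup hermForm)
-- `Classical`: the place subtypes indexing `mixedSpace L` are `Fintype` classically
open scoped Matrix MatrixGroups ComplexOrder ContDiff Classical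
open scoped Matrix.Norms.Operator

namespace Summit.HodgeConjecture.HodgeConjecture.Cruxes.H413.K2E4ExplicitArchSingularTransferEngine

/-! ## §0–§1 Small facts, the abstract joint induction (★ p854825 restated), the central curve -/

/-- A `Fin 3`-indexed family with pairwise distinct values is injective. [folklore] -/
theorem injective_of_pairwise_ne_three {β : Type*} {f : Fin 3 → β} (h01 : f 0 ≠ f 1) (h02 : f 0 ≠ f 2) (h12 : f 1 ≠ f 2) : Function.Injective f := by
  intro i j hij
  fin_cases i <;> fin_cases j
  · rfl
  · exact absurd hij h01
  · exact absurd hij h02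
  · exact absurd hij.symm h01
  · rfl
  · exact absurd hij h12
  · exact absurd hij.symm h02
  · exact absurd hij.symm h12
  · rfl

/-- **The joint place-by-place induction** (★ p854825 `eq_of_step_of_regular_eq`, K2E4-p11, restated privately until its module is built on the check farm — adapted verbatim):
two state families with their own one-step laws along the same curve∕observable∕filter which agree at every regular datum at `S = ∅` agree at `S = univ`.
[cite: Rogawski1990, §8.2 Prop. 8.2.1 (a) pp. 118–119; §14.5 Lemma 14.5.2 (b) pp. 238–239] -/
theorem joint_induction {W : Type*} [Fintype W] [DecidableEq W] {Z : W → Type*} {F : Type*} [NormedAddCommGroup F] [NormedSpace ℝ F]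
    (Reg : ∀ v : W, Z v → Prop) (A B : Finset W → (∀ v, Z v) → F) (γ : ∀ w : W, ℝ → Z w)
    (G : ℝ → F → F) (l : Filter ℝ) [l.NeBot]
    (hγ : ∀ w, ∀ᶠ ψ in l, ∀ᶠ ψ' in 𝓝 ψ, Reg w (γ w ψ'))
    (hreg : ∀ z : ∀ v, Z v, (∀ v, Reg v (z v)) → A ∅ z = B ∅ z)
    (hA : ∀ (S : Finset W) (w : W), w ∉ S → ∀ z : ∀ v, Z v, (∀ v, v ∉ S → v ≠ w → Reg v (z v)) →
      Tendsto (fun ψ : ℝ => deriv (fun ψ : ℝ => G ψ (A S (Function.update z w (γ w ψ)))) ψ) l (𝓝 (A (insert w S) z)))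
    (hB : ∀ (S : Finset W) (w : W), w ∉ S → ∀ z : ∀ v, Z v, (∀ v, v ∉ S → v ≠ w → Reg v (z v)) →
      Tendsto (fun ψ : ℝ => deriv (fun ψ : ℝ => G ψ (B S (Function.update z w (γ w ψ)))) ψ) l (𝓝 (B (insert w S) z))) :
    ∀ z : ∀ v, Z v, A Finset.univ z = B Finset.univ z := by
  classical
  suffices hS : ∀ (S : Finset W) (z : ∀ v, Z v), (∀ v, v ∉ S → Reg v (z v)) → A S z = B S z from
    fun z => hS Finset.univ z fun v hv => absurd (Finset.mem_univ v) hv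
  intro S
  induction S using Finset.induction_on with
  | empty =>
    intro z hz
    exact hreg z fun v => hz v (Finset.notMem_empty v)
  | @insert w S hw ih =>
    intro z hz
    have hz' : ∀ v, v ∉ S → v ≠ w → Reg v (z v) := fun v hvS hvw =>
      hz v (by simp only [Finset.mem_insert, hvw, hvS, or_self, not_false_eq_true])
    have hev : (fun ψ : ℝ => deriv (fun ψ : ℝ => G ψ (A S (Function.update z w (γ w ψ)))) ψ) =ᶠ[l]
        fun ψ : ℝ => deriv (fun ψ : ℝ => G ψ (B S (Function.update z w (γ w ψ)))) ψ := by
      filter_upwards [hγ w] with ψ hψ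
      refine Filter.EventuallyEq.deriv_eq ?_
      filter_upwards [hψ] with ψ' hψ'
      rw [ih (Function.update z w (γ w ψ')) fun v hvS => ?_]
      by_cases hvw : v = w
      · subst hvw
        rw [Function.update_self]
        exact hψ'
      · rw [Function.update_of_ne hvw]
        exact hz' v hvS hvw
    exact tendsto_nhds_unique_of_eventuallyEq (hA S w hw z hz') (hB S w hw z hz') hev

/-- Along the central curve `ψ ↦ (z e^{iψ}, z e^{−iψ})` the 2-block datum is `G`-regular off `ψ = 0`, locally: the two angles differ and avoid any point `δ ≠ z` near `ψ = 0`.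
[cite: Rogawski1990, §8.2 p. 118] -/
theorem eventually_nhdsGT_regular_centralCurve (z δ : Circle) (hzδ : z ≠ δ) :
    ∀ᶠ ψ in 𝓝[>] (0 : ℝ), ∀ᶠ ψ' in 𝓝 ψ,
      (![z * Circle.exp ψ', z * Circle.exp (-ψ')] : Fin 2 → Circle) 0 ≠ (![z * Circle.exp ψ', z * Circle.exp (-ψ')] : Fin 2 → Circle) 1 ∧
        (![z * Circle.exp ψ', z * Circle.exp (-ψ')] : Fin 2 → Circle) 0 ≠ δ ∧ (![z * Circle.exp ψ', z * Circle.exp (-ψ')] : Fin 2 → Circle) 1 ≠ δ := by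
  have hne : ∀ᶠ ψ in 𝓝[≠] (0 : ℝ), (![z * Circle.exp ψ, z * Circle.exp (-ψ)] : Fin 2 → Circle) 0 ≠ (![z * Circle.exp ψ, z * Circle.exp (-ψ)] : Fin 2 → Circle) 1 ∧
      (![z * Circle.exp ψ, z * Circle.exp (-ψ)] : Fin 2 → Circle) 0 ≠ δ ∧ (![z * Circle.exp ψ, z * Circle.exp (-ψ)] : Fin 2 → Circle) 1 ≠ δ := by
    -- the avoidance of `δ` is an open condition holding at `ψ = 0`
    have h0 : ∀ᶠ ψ in 𝓝 (0 : ℝ), z * Circle.exp ψ ≠ δ ∧ z * Circle.exp (-ψ) ≠ δ := by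
      have hc1 : Continuous fun ψ : ℝ => z * Circle.exp ψ := continuous_const.mul Circle.exp.continuous
      have hc2 : Continuous fun ψ : ℝ => z * Circle.exp (-ψ) := continuous_const.mul (Circle.exp.continuous.comp continuous_neg)
      have h1 : ∀ᶠ ψ in 𝓝 (0 : ℝ), z * Circle.exp ψ ≠ δ := by
        refine (hc1.continuousAt.eventually_ne ?_)
        simpa only [Circle.exp_zero, mul_one] using hzδ
      have h2 : ∀ᶠ ψ in 𝓝 (0 : ℝ), z * Circle.exp (-ψ) ≠ δ := by
        refine (hc2.continuousAt.eventually_ne ?_)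
        simpa only [neg_zero, Circle.exp_zero, mul_one] using hzδ
      exact h1.and h2
    have hIoo : ∀ᶠ ψ : ℝ in 𝓝[≠] 0, ψ ∈ Ioo (-1 : ℝ) 1 ∧ ψ ≠ 0 :=
      Filter.inter_mem (mem_nhdsWithin_of_mem_nhds (Ioo_mem_nhds (by norm_num) (by norm_num))) self_mem_nhdsWithin
    filter_upwards [hIoo, mem_nhdsWithin_of_mem_nhds h0] with ψ hψ hψδ
    exact ⟨UnitaryGroup.mul_exp_ne_mul_exp_neg z hψ.1 hψ.2, hψδ.1, hψδ.2⟩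
  -- `𝓝[≠] 0`-eventually ⇒ locally `𝓝[≠] 0`-eventually (★ p854825 `eventually_eventually_nhds_of_eventually_nhdsNE`, inlined), then restrict to `𝓝[>] 0`
  have hloc : ∀ᶠ ψ in 𝓝[≠] (0 : ℝ), ∀ᶠ ψ' in 𝓝 ψ, (![z * Circle.exp ψ', z * Circle.exp (-ψ')] : Fin 2 → Circle) 0 ≠ (![z * Circle.exp ψ', z * Circle.exp (-ψ')] : Fin 2 → Circle) 1 ∧
      (![z * Circle.exp ψ', z * Circle.exp (-ψ')] : Fin 2 → Circle) 0 ≠ δ ∧ (![z * Circle.exp ψ', z * Circle.exp (-ψ')] : Fin 2 → Circle) 1 ≠ δ := by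
    rw [eventually_nhdsWithin_iff] at hne ⊢
    filter_upwards [hne.eventually_nhds] with x hx hxa
    filter_upwards [hx, isOpen_ne.mem_nhds hxa] with y hy hya
    exact hy hya
  exact hloc.filter_mono (nhdsWithin_mono _ fun x hx => ne_of_gt hx)

/-- `∂_ψ [2 sin ψ • (c · F(ψ))] = c · ∂_ψ [2 sin ψ • F(ψ)]` (no differentiability needed: `c ·` is a field multiplication). [folklore] -/
theorem deriv_two_sin_smul_const_mul (c : ℂ) (F : ℝ → ℂ) (ψ : ℝ) :
    deriv (fun ψ : ℝ => (2 * Real.sin ψ) • (c * F ψ)) ψ = c * deriv (fun ψ : ℝ => (2 * Real.sin ψ) • F ψ) ψ := by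
  have h : (fun ψ : ℝ => (2 * Real.sin ψ) • (c * F ψ)) = fun ψ : ℝ => c * ((2 * Real.sin ψ) • F ψ) :=
    funext fun ψ => (mul_smul_comm _ _ _).symm
  rw [h, deriv_const_mul_field]

/-! ## §2 The speed-0 adapter and the Haar property of `νHi` -/

section Adapter

variable (L : Type) [Field L] [NumberField L] [IsCMField L] (H' : Matrix (Fin 3) (Fin 3) L)

/-- **THE SPEED-0 ADAPTER.**  On a rational diagonal frame `Φ : U(diagonal α′)_∞ ≃ₜ* U(H′)_∞` (`g ↦ (P⊗1) g (P⊗1)⁻¹`, `α′_i ≠ 0` real), at a 2-block datum `u` that is `G`-regular against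
the frozen `U(Φ₁)`-angle `σ_w e₂` (`u_w,0 ≠ u_w,1`, `u_w,i ≠ σ_w e₂`), the `H_∞`-point `(Φ_{Q₂}⁻¹ t₂(u), e₂ ⊗ 1)` is `G`-regular and every norm partner of it in `U(H′)_∞` has compact
centraliser: B-p12's curve at speed `0` through `(u_0, σe₂, u_1)` (★ `isArchGRegular_archSingularCurve`, ★ `compactSpace_centralizer_of_isArchNormPair_archSingularCurve`, ★ (α)
`compactSpace_centralizer_of_isArchNormPair_of_archCongr`, ★ `archCongrOfEq_quasiSplitFrameTwo_symm_archDiagTorus`) — the binders `hreg`, `hZ′` of ★ (β₀) at EVERY regular datum.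
[cite: Rogawski1990, §3.1 p. 19; §14.3 p. 234] -/
theorem twoBlockPoint_isArchGRegular_and_compactSpace (α' : Fin 3 → L) (hα' : ∀ i, α' i ≠ 0) (hαherm : ∀ i, (IsCMField.complexConj L (α' i) : L) = α' i)
    (P : GL (Fin 3) L) (Φ : UnitaryGroup.arch (↥(maximalRealSubfield L)) L (IsCMField.complexConj L) 3 (Matrix.diagonal α') ≃ₜ* UnitaryGroup.arch (↥(maximalRealSubfield L)) L (IsCMField.complexConj L) 3 H')
    (hΦ : ∀ g, ((Φ g : UnitaryGroup.arch (↥(maximalRealSubfield L)) L (IsCMField.complexConj L) 3 H') : GL (Fin 3) (mixedSpace L)) =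
      Matrix.GeneralLinearGroup.map (mixedEmbedding L) P * (g : GL (Fin 3) (mixedSpace L)) * (Matrix.GeneralLinearGroup.map (mixedEmbedding L) P)⁻¹)
    (e₂ : L) (h₂ : (IsCMField.complexConj L e₂ : L) * e₂ = 1) (u : {w : InfinitePlace L // IsComplex w} → Fin 2 → Circle)
    (hu : ∀ w, u w 0 ≠ u w 1 ∧ u w 0 ≠ (⟨w.1.embedding e₂, mem_sphere_zero_iff_norm.mpr (UnitaryGroup.norm_embedding_eq_one_of_complexConj_mul_self L e₂ h₂ w)⟩ : Circle) ∧ u w 1 ≠ (⟨w.1.embedding e₂, mem_sphere_zero_iff_norm.mpr (UnitaryGroup.norm_embedding_eq_one_of_complexConj_mul_self L e₂ h₂ w)⟩ : Circle)) :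
    IsArchGRegular L ((unitaryGroupOfFormCongrOfEq (UnitaryGroup.conjMixed (↥(maximalRealSubfield L)) L (IsCMField.complexConj L))
          (Matrix.GeneralLinearGroup.map (mixedEmbedding L) (Matrix.GeneralLinearGroup.mkOfDetNeZero !![(1 : L), 1; 1, -1] (UnitaryGroup.det_quasiSplitFrameTwo_ne_zero L)))
          (UnitaryGroup.archFormOf L 2 (Matrix.diagonal ![(2 : L)⁻¹, -(2 : L)⁻¹])) (UnitaryGroup.archFormOf L 2 (Matrix.of fun i j : Fin 2 => if i.val + j.val + 1 = 2 then (1 : L) else 0))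
          (UnitaryGroup.formCongr_map_mixedEmbedding_archFormOf_eq L (UnitaryGroup.formCongr_quasiSplitFrameTwo_diagonal L))).symm (UnitaryGroup.archDiagTorus L 2 ![(2 : L)⁻¹, -(2 : L)⁻¹] u),
      ((UnitaryGroup.archPiEquivCM 1 L (Matrix.of fun i j : Fin 1 => if i.val + j.val + 1 = 1 then (1 : L) else 0)).symm fun w =>
          ⟨UnitaryGroup.circleDiagonal 1 ![(⟨w.1.embedding e₂, mem_sphere_zero_iff_norm.mpr (UnitaryGroup.norm_embedding_eq_one_of_complexConj_mul_self L e₂ h₂ w)⟩ : Circle)], UnitaryGroup.circleDiagonal_mem_archLocal_antidiagOne L w _⟩)) ∧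
    ∀ γ', IsArchNormPair L H' ((unitaryGroupOfFormCongrOfEq (UnitaryGroup.conjMixed (↥(maximalRealSubfield L)) L (IsCMField.complexConj L))
          (Matrix.GeneralLinearGroup.map (mixedEmbedding L) (Matrix.GeneralLinearGroup.mkOfDetNeZero !![(1 : L), 1; 1, -1] (UnitaryGroup.det_quasiSplitFrameTwo_ne_zero L)))
          (UnitaryGroup.archFormOf L 2 (Matrix.diagonal ![(2 : L)⁻¹, -(2 : L)⁻¹])) (UnitaryGroup.archFormOf L 2 (Matrix.of fun i j : Fin 2 => if i.val + j.val + 1 = 2 then (1 : L) else 0))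
          (UnitaryGroup.formCongr_map_mixedEmbedding_archFormOf_eq L (UnitaryGroup.formCongr_quasiSplitFrameTwo_diagonal L))).symm (UnitaryGroup.archDiagTorus L 2 ![(2 : L)⁻¹, -(2 : L)⁻¹] u),
      ((UnitaryGroup.archPiEquivCM 1 L (Matrix.of fun i j : Fin 1 => if i.val + j.val + 1 = 1 then (1 : L) else 0)).symm fun w =>
          ⟨UnitaryGroup.circleDiagonal 1 ![(⟨w.1.embedding e₂, mem_sphere_zero_iff_norm.mpr (UnitaryGroup.norm_embedding_eq_one_of_complexConj_mul_self L e₂ h₂ w)⟩ : Circle)], UnitaryGroup.circleDiagonal_mem_archLocal_antidiagOne L w _⟩)) γ' →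
      CompactSpace (Subgroup.centralizer ({γ'} : Set (UnitaryGroup.arch (↥(maximalRealSubfield L)) L (IsCMField.complexConj L) 3 H'))) := by
  -- B-p12's curve at speed 0 through `(u_0, δ, u_1)`
  obtain ⟨z₀, hz₀⟩ : ∃ z₀ : {w : InfinitePlace L // IsComplex w} → Fin 3 → Circle, z₀ = fun w => ![u w 0, (⟨w.1.embedding e₂, mem_sphere_zero_iff_norm.mpr (UnitaryGroup.norm_embedding_eq_one_of_complexConj_mul_self L e₂ h₂ w)⟩ : Circle), u w 1] := ⟨_, rfl⟩
  obtain ⟨c₀, hc₀⟩ : ∃ c₀ : {w : InfinitePlace L // IsComplex w} → ℝ, c₀ = fun _ => 0 := ⟨_, rfl⟩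
  obtain ⟨γHc, hγHc⟩ : ∃ γHc : ℝ → (UnitaryGroup.arch (↥(maximalRealSubfield L)) L (IsCMField.complexConj L) 2 (Matrix.of fun i j : Fin 2 => if i.val + j.val + 1 = 2 then (1 : L) else 0) ×
      UnitaryGroup.arch (↥(maximalRealSubfield L)) L (IsCMField.complexConj L) 1 (Matrix.of fun i j : Fin 1 => if i.val + j.val + 1 = 1 then (1 : L) else 0)), γHc = fun ψ =>
    ((UnitaryGroup.archPiEquivCM 2 L (Matrix.of fun i j : Fin 2 => if i.val + j.val + 1 = 2 then (1 : L) else 0)).symm fun w =>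
        ⟨Matrix.GeneralLinearGroup.mkOfDetNeZero !![(1 : ℂ), 1; 1, -1] UnitaryGroup.det_cayleyTwo_ne_zero *
            UnitaryGroup.circleDiagonal 2 ![z₀ w 0 * Circle.exp (![(1 : ℝ), 0, -1] 0 * (c₀ w * ψ)), z₀ w 2 * Circle.exp (![(1 : ℝ), 0, -1] 2 * (c₀ w * ψ))] *
          (Matrix.GeneralLinearGroup.mkOfDetNeZero !![(1 : ℂ), 1; 1, -1] UnitaryGroup.det_cayleyTwo_ne_zero)⁻¹,
          UnitaryGroup.cayley_conj_circleDiagonal_mem_archLocal L w _⟩,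
      (UnitaryGroup.archPiEquivCM 1 L (Matrix.of fun i j : Fin 1 => if i.val + j.val + 1 = 1 then (1 : L) else 0)).symm fun w =>
        ⟨UnitaryGroup.circleDiagonal 1 ![z₀ w 1 * Circle.exp (![(1 : ℝ), 0, -1] 1 * (c₀ w * ψ))],
          UnitaryGroup.circleDiagonal_mem_archLocal_antidiagOne L w _⟩) := ⟨_, rfl⟩
  obtain ⟨γGc, hγGc⟩ : ∃ γGc : ℝ → UnitaryGroup.arch (↥(maximalRealSubfield L)) L (IsCMField.complexConj L) 3 (Matrix.diagonal α'),
      γGc = fun ψ => UnitaryGroup.archDiagTorus L 3 α' fun w i => z₀ w i * Circle.exp (![(1 : ℝ), 0, -1] i * (c₀ w * ψ)) := ⟨_, rfl⟩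
  have hinj : ∀ w : {w : InfinitePlace L // IsComplex w}, Function.Injective (fun i : Fin 3 => z₀ w i * Circle.exp (![(1 : ℝ), 0, -1] i * (c₀ w * 0))) := by
    intro w
    have hfun : (fun i : Fin 3 => z₀ w i * Circle.exp (![(1 : ℝ), 0, -1] i * (c₀ w * 0))) = z₀ w := by
      funext i
      rw [mul_zero, mul_zero, Circle.exp_zero, mul_one]
    rw [hfun, hz₀]
    exact injective_of_pairwise_ne_three (hu w).2.1 (hu w).1 (fun h => (hu w).2.2 h.symm)
  have hU : (fun w => ![z₀ w 0 * Circle.exp (![(1 : ℝ), 0, -1] 0 * (c₀ w * 0)), z₀ w 2 * Circle.exp (![(1 : ℝ), 0, -1] 2 * (c₀ w * 0))]) = u := by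
    funext w
    rw [mul_zero, mul_zero, mul_zero, Circle.exp_zero, mul_one, mul_one, hz₀]
    funext i
    fin_cases i <;> rfl
  have hUw : ∀ w, (![z₀ w 0 * Circle.exp (![(1 : ℝ), 0, -1] 0 * (c₀ w * 0)), z₀ w 2 * Circle.exp (![(1 : ℝ), 0, -1] 2 * (c₀ w * 0))] : Fin 2 → Circle) = u w :=
    fun w => congrFun hU w
  have hpt0 : γHc 0 = ((unitaryGroupOfFormCongrOfEq (UnitaryGroup.conjMixed (↥(maximalRealSubfield L)) L (IsCMField.complexConj L))
          (Matrix.GeneralLinearGroup.map (mixedEmbedding L) (Matrix.GeneralLinearGroup.mkOfDetNeZero !![(1 : L), 1; 1, -1] (UnitaryGroup.det_quasiSplitFrameTwo_ne_zero L)))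
          (UnitaryGroup.archFormOf L 2 (Matrix.diagonal ![(2 : L)⁻¹, -(2 : L)⁻¹])) (UnitaryGroup.archFormOf L 2 (Matrix.of fun i j : Fin 2 => if i.val + j.val + 1 = 2 then (1 : L) else 0))
          (UnitaryGroup.formCongr_map_mixedEmbedding_archFormOf_eq L (UnitaryGroup.formCongr_quasiSplitFrameTwo_diagonal L))).symm (UnitaryGroup.archDiagTorus L 2 ![(2 : L)⁻¹, -(2 : L)⁻¹] u),
      ((UnitaryGroup.archPiEquivCM 1 L (Matrix.of fun i j : Fin 1 => if i.val + j.val + 1 = 1 then (1 : L) else 0)).symm fun w =>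
          ⟨UnitaryGroup.circleDiagonal 1 ![(⟨w.1.embedding e₂, mem_sphere_zero_iff_norm.mpr (UnitaryGroup.norm_embedding_eq_one_of_complexConj_mul_self L e₂ h₂ w)⟩ : Circle)], UnitaryGroup.circleDiagonal_mem_archLocal_antidiagOne L w _⟩)) := by
    refine Prod.ext ?_ ?_
    · refine Eq.trans ?_ (UnitaryGroup.archCongrOfEq_quasiSplitFrameTwo_symm_archDiagTorus (L := L) u).symm
      rw [hγHc]
      simp only [hUw]
    · rw [hγHc]
      simp only
      congr 1
      funext w
      apply Subtype.ext
      show UnitaryGroup.circleDiagonal 1 _ = UnitaryGroup.circleDiagonal 1 _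
      congr 1
      funext i
      fin_cases i
      show z₀ w 1 * Circle.exp (0 * (c₀ w * 0)) = _
      rw [zero_mul, Circle.exp_zero, mul_one, hz₀]
      rfl
  have hreg : IsArchGRegular L (γHc 0) := isArchGRegular_archSingularCurve L α' z₀ c₀ γHc γGc hγHc hγGc 0 hinj
  have hZ' : ∀ γ', IsArchNormPair L H' (γHc 0) γ' → CompactSpace (Subgroup.centralizer ({γ'} : Set (UnitaryGroup.arch (↥(maximalRealSubfield L)) L (IsCMField.complexConj L) 3 H'))) :=
    compactSpace_centralizer_of_isArchNormPair_of_archCongr L (Matrix.GeneralLinearGroup.map (mixedEmbedding L) P) Φ hΦ (γHc 0)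
      (fun g hg => compactSpace_centralizer_of_isArchNormPair_archSingularCurve L α' z₀ c₀ γHc γGc hγHc hγGc hα' hαherm 0 hinj g hg)
  rw [hpt0] at hreg hZ'
  exact ⟨hreg, hZ'⟩

variable
  [MeasurableSpace (UnitaryGroup.arch (↥(maximalRealSubfield L)) L (IsCMField.complexConj L) 2 (Matrix.of fun i j : Fin 2 => if i.val + j.val + 1 = 2 then (1 : L) else 0) ×
      UnitaryGroup.arch (↥(maximalRealSubfield L)) L (IsCMField.complexConj L) 1 (Matrix.of fun i j : Fin 1 => if i.val + j.val + 1 = 1 then (1 : L) else 0))]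
  [BorelSpace (UnitaryGroup.arch (↥(maximalRealSubfield L)) L (IsCMField.complexConj L) 2 (Matrix.of fun i j : Fin 2 => if i.val + j.val + 1 = 2 then (1 : L) else 0) ×
      UnitaryGroup.arch (↥(maximalRealSubfield L)) L (IsCMField.complexConj L) 1 (Matrix.of fun i j : Fin 1 => if i.val + j.val + 1 = 1 then (1 : L) else 0))]
  [∀ a : (UnitaryGroup.arch (↥(maximalRealSubfield L)) L (IsCMField.complexConj L) 2 (Matrix.of fun i j : Fin 2 => if i.val + j.val + 1 = 2 then (1 : L) else 0) ×
      UnitaryGroup.arch (↥(maximalRealSubfield L)) L (IsCMField.complexConj L) 1 (Matrix.of fun i j : Fin 1 => if i.val + j.val + 1 = 1 then (1 : L) else 0)),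
    MeasurableSpace ((UnitaryGroup.arch (↥(maximalRealSubfield L)) L (IsCMField.complexConj L) 2 (Matrix.of fun i j : Fin 2 => if i.val + j.val + 1 = 2 then (1 : L) else 0) ×
      UnitaryGroup.arch (↥(maximalRealSubfield L)) L (IsCMField.complexConj L) 1 (Matrix.of fun i j : Fin 1 => if i.val + j.val + 1 = 1 then (1 : L) else 0)) ⧸ Subgroup.centralizer ({a} : Set (UnitaryGroup.arch (↥(maximalRealSubfield L)) L (IsCMField.complexConj L) 2 (Matrix.of fun i j : Fin 2 => if i.val + j.val + 1 = 2 then (1 : L) else 0) ×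
      UnitaryGroup.arch (↥(maximalRealSubfield L)) L (IsCMField.complexConj L) 1 (Matrix.of fun i j : Fin 1 => if i.val + j.val + 1 = 1 then (1 : L) else 0))))]
  [∀ a : (UnitaryGroup.arch (↥(maximalRealSubfield L)) L (IsCMField.complexConj L) 2 (Matrix.of fun i j : Fin 2 => if i.val + j.val + 1 = 2 then (1 : L) else 0) ×
      UnitaryGroup.arch (↥(maximalRealSubfield L)) L (IsCMField.complexConj L) 1 (Matrix.of fun i j : Fin 1 => if i.val + j.val + 1 = 1 then (1 : L) else 0)),
    BorelSpace ((UnitaryGroup.arch (↥(maximalRealSubfield L)) L (IsCMField.complexConj L) 2 (Matrix.of fun i j : Fin 2 => if i.val + j.val + 1 = 2 then (1 : L) else 0) ×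
      UnitaryGroup.arch (↥(maximalRealSubfield L)) L (IsCMField.complexConj L) 1 (Matrix.of fun i j : Fin 1 => if i.val + j.val + 1 = 1 then (1 : L) else 0)) ⧸ Subgroup.centralizer ({a} : Set (UnitaryGroup.arch (↥(maximalRealSubfield L)) L (IsCMField.complexConj L) 2 (Matrix.of fun i j : Fin 2 => if i.val + j.val + 1 = 2 then (1 : L) else 0) ×
      UnitaryGroup.arch (↥(maximalRealSubfield L)) L (IsCMField.complexConj L) 1 (Matrix.of fun i j : Fin 1 => if i.val + j.val + 1 = 1 then (1 : L) else 0))))]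

/-- **`νHi` IS A HAAR MEASURE** once the `H_∞`-family is the Weil quotient of `νHi` on the `G`-regular classes ((W_H)) and admissible there ((iii)): at the class of any `G`-regular point
the member is a non-zero Weil quotient, so `νHi ≠ 0`; right-invariant + Radon + non-zero on the unimodular product `U(Φ₂)_∞ × U(Φ₁)_∞` (★ `modularCharacterFun_arch_eq_one`,
★ `isMulRightInvariant_prod`) is Haar (★ `IsQuotientOf.isHaarMeasure_of_isAdmissibleOn`). [cite: Rogawski1990, §1.7 p. 6; §4.3 (4.3.1) p. 43] [cite: Folland1999, Thm 11.9] -/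
theorem isHaarMeasure_H_of_isQuotientOf (νHi : Measure (UnitaryGroup.arch (↥(maximalRealSubfield L)) L (IsCMField.complexConj L) 2 (Matrix.of fun i j : Fin 2 => if i.val + j.val + 1 = 2 then (1 : L) else 0) ×
      UnitaryGroup.arch (↥(maximalRealSubfield L)) L (IsCMField.complexConj L) 1 (Matrix.of fun i j : Fin 1 => if i.val + j.val + 1 = 1 then (1 : L) else 0))) [IsFiniteMeasureOnCompacts νHi] [νHi.IsMulRightInvariant]
    (mHi : OrbitalMeasureFamily (UnitaryGroup.arch (↥(maximalRealSubfield L)) L (IsCMField.complexConj L) 2 (Matrix.of fun i j : Fin 2 => if i.val + j.val + 1 = 2 then (1 : L) else 0) ×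
      UnitaryGroup.arch (↥(maximalRealSubfield L)) L (IsCMField.complexConj L) 1 (Matrix.of fun i j : Fin 1 => if i.val + j.val + 1 = 1 then (1 : L) else 0)))
    (tH : ∀ γH : (UnitaryGroup.arch (↥(maximalRealSubfield L)) L (IsCMField.complexConj L) 2 (Matrix.of fun i j : Fin 2 => if i.val + j.val + 1 = 2 then (1 : L) else 0) ×
      UnitaryGroup.arch (↥(maximalRealSubfield L)) L (IsCMField.complexConj L) 1 (Matrix.of fun i j : Fin 1 => if i.val + j.val + 1 = 1 then (1 : L) else 0)), Measure (Subgroup.centralizer ({γH} : Set (UnitaryGroup.arch (↥(maximalRealSubfield L)) L (IsCMField.complexConj L) 2 (Matrix.of fun i j : Fin 2 => if i.val + j.val + 1 = 2 then (1 : L) else 0) ×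
      UnitaryGroup.arch (↥(maximalRealSubfield L)) L (IsCMField.complexConj L) 1 (Matrix.of fun i j : Fin 1 => if i.val + j.val + 1 = 1 then (1 : L) else 0)))))
    (hWH : mHi.IsQuotientOf (IsArchGRegular L) νHi tH) (hadmH : mHi.IsAdmissibleOn (IsArchGRegular L))
    (x : (UnitaryGroup.arch (↥(maximalRealSubfield L)) L (IsCMField.complexConj L) 2 (Matrix.of fun i j : Fin 2 => if i.val + j.val + 1 = 2 then (1 : L) else 0) ×
      UnitaryGroup.arch (↥(maximalRealSubfield L)) L (IsCMField.complexConj L) 1 (Matrix.of fun i j : Fin 1 => if i.val + j.val + 1 = 1 then (1 : L) else 0))) (hx : IsArchGRegular L x) : νHi.IsHaarMeasure := by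
  have hcl : IsArchGRegular L (Quotient.out (ConjClasses.mk x) : (UnitaryGroup.arch (↥(maximalRealSubfield L)) L (IsCMField.complexConj L) 2 (Matrix.of fun i j : Fin 2 => if i.val + j.val + 1 = 2 then (1 : L) else 0) ×
      UnitaryGroup.arch (↥(maximalRealSubfield L)) L (IsCMField.complexConj L) 1 (Matrix.of fun i j : Fin 1 => if i.val + j.val + 1 = 1 then (1 : L) else 0))) := by
    obtain ⟨q, hq⟩ := isConj_iff.mp (ConjClasses.mk_eq_mk_iff_isConj.mp (Quotient.out_eq (ConjClasses.mk x)).symm)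
    rw [← hq]
    exact isArchGRegular_conj L x q hx
  have hherm₂ := UnitaryGroup.antidiagOne_isHermitian L 2
  have hd₂ : (Matrix.of fun i j : Fin 2 => if i.val + j.val + 1 = 2 then (1 : L) else 0).det ≠ 0 := (UnitaryGroup.isUnit_antidiagOne_det L 2).ne_zero
  have hherm₁ := UnitaryGroup.antidiagOne_isHermitian L 1
  have hd₁ : (Matrix.of fun i j : Fin 1 => if i.val + j.val + 1 = 1 then (1 : L) else 0).det ≠ 0 := (UnitaryGroup.isUnit_antidiagOne_det L 1).ne_zero
  haveI : (Measure.haar : Measure (UnitaryGroup.arch (↥(maximalRealSubfield L)) L (IsCMField.complexConj L) 2 (Matrix.of fun i j : Fin 2 => if i.val + j.val + 1 = 2 then (1 : L) else 0) ×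
      UnitaryGroup.arch (↥(maximalRealSubfield L)) L (IsCMField.complexConj L) 1 (Matrix.of fun i j : Fin 1 => if i.val + j.val + 1 = 1 then (1 : L) else 0))).IsMulRightInvariant :=
    isMulRightInvariant_prod (UnitaryGroup.modularCharacterFun_arch_eq_one L _ hherm₂ hd₂) (UnitaryGroup.modularCharacterFun_arch_eq_one L _ hherm₁ hd₁) _
  exact hWH.isHaarMeasure_of_isAdmissibleOn hadmH (ConjClasses.mk x) hcl Measure.haar

end Adapter

end Summit.HodgeConjecture.HodgeConjecture.Cruxes.H413.K2E4ExplicitArchSingularTransferEngine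

end
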